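import Summits.QuantumFields.YangMills.Theorems.BalabanUVNodesN22WindowedNE9Dichotomy

/-!
# BalabanUVNodes ∕ node N22 = NE9 — PRINT's DICHOTOMY IN KERNEL CURRENCY, THE (β′) LETTER: `WindowedNE9 F (localizedSum F S emb) …` from printed (2.38),
# ACTIVITY-level coupling-holomorphy margins in the OLDER couplings only, and an OUTPUT-level last-coupling Lipschitz letter ∕ `EHoloAt`-shape datum ∕
# relative-disc (dilation) datum — no activity-level slot in the last coupling

Cell `pub-ymgap`, HUMAN RULING D-0062 (Track A), R134 seat `pub-ymgap-dag-n22-c` (strategy s1), generation 13, module J33 part 2 (the 400-line cap splits J33).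
THEOREMS ONLY (no `def`, no `sorry`); imports part 1 `…Theorems.BalabanUVNodesN22WindowedNE9Dichotomy` (§1–§4: `youngLipschitz_pinLast_of_olderCoordHolo`,
`norm_clusterStepE_sub_le_of_olderCoordHolo_lastLetter`, `lastLetter_of_lastOutputHolo(Rel)`, `abs_polWindow_localizedSum_sub_le_soft_of_dichotomy`,
`dichotomySummand_le_softMajorant`) and through it J29–J32′ and dag-n22-w2's `windowedNE9_localizedSum_of_softSum` — consumed BY NAME.  Filed
`--supports stmt-QuantumFields-20544` (K3⁷ `SpineGivenEndpointR13SepCoPH`) as a HELPER.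

WHY ∕ MECHANISM: part 1's header — [II] p. 12 (2.3): the small-field cut-off `χ(|B(b)| < ε₁∕g_k)` reads the LAST coupling only, so OLDER couplings complexify at
ACTIVITY level (node N10's T-row «(or analytic)»), while the last coupling's printed regularity is [I] p. 263's OUTPUT-level clause «It is a C^∞-function of
g_{j−1} ∈ [0, γ], (or analytic)» (node N09's `EHoloAt` currency); telescoping split at the last coordinate + J30's engine on the prefix set pinned there.

WHAT (0 `def`, 0 `sorry`).  ★★★ `windowedNE9_localizedSum_of_olderCoordHolo_lastLetter` — the letter from (i) printed `Bound238` on the boxes, (ii) older-coordinate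
activity margins `ϱt (k+1) i`, (iii) an OUTPUT-level last-coupling Lipschitz letter `Λ_E`, + the readings ∕ tails ∕ numerals of (A) p605956; ★★★ `…_lastOutputHolo` —
(iii) from an `EHoloAt`-shape datum (uniform `r_E`-discs about `]0, γ]` at OUTPUT level, bound `B e^{−κ_E d}`; `Λ_E = 4B∕r_E`); ★ `…_lastOutputHoloRel` — (iii) from
the relative-disc datum `D̄(s, c·s)` with bound `B′ s e^{−κ_E d}` (print's dilation shape AT OUTPUT LEVEL; `Λ_E = 8B′∕min(c,1)`).  Moduli `C·Λ^D`,
`Λ^D n i = if i + 1 < n then c₀·4A∕ϱt n i else Λ_E`, `c₀ = 8·e·9·64·K₀(64,8)²`, `C = (16B₃²∕r²)e^{12Mδ₁}K₀(64,8)K₁(4,δ₀∕2)`, `δ₁ = ½min{δ₀, κ(4M)⁻¹}`.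

HONEST FRAMING.  Count-neutral helper ∕ junction; no estimate of Bałaban's is proved or asserted.  DISPLAYED (hypotheses), with owners: printed (2.38) on the boxes
(node N10); the older-coordinate activity margins (N10's T-row complexified ∕ NODE A at the towers of record); the OUTPUT-level last-coupling letter ∕ datum (node
N09's `EHoloAt` family at the towers of record — the instance is one `exact` in N09's currency, not typed here; the relative edition is the cell's reading of print's
dilation, NOT a printed estimate); activity holomorphy through the complexified readings, the readings' chart ∕ space clauses, the tails and the numerals exactly as
in (A).  Nothing of Bałaban's is constructed; N22 NOT discharged (typed 28∕28 · discharged 5∕27 UNCHANGED); K3⁷ OPEN; NE9 NOT IN PRINT for d = 4; one finite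
four-torus programme at fixed ε — NOT infinite volume, NOT OS on ℝ⁴, NOT a mass gap, NOT Clay.  0 `sorry`, 0 `def`, standard axioms.  References (TYPES only):
[I] = [Balaban1987RG1] CMP 109 (1987) §1 p. 263, (1.7) p. 261, (1.20)–(1.21) p. 264, p. 282, (5.10) p. 293; [II] = [Balaban1988RG2Cluster] CMP 116 (1988) (2.3)
p. 12, (2.13)–(2.14) pp. 14–15, (2.38) p. 20, (2.39)–(2.41) p. 21.
-/

noncomputable section

open Filter Topology Set Metric
open scoped BigOperators

namespace YMDAG.N22.Dichotomy

open Literature.MathematicalPhysics.QuantumFieldTheory.Balaban1983to89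
open Literature.MathematicalPhysics.QuantumFieldTheory.Balaban1983to89.T4Continuum (T4Family)
open Literature.MathematicalPhysics.QuantumFieldTheory.Balaban1983to89.T4OutputRate (Window)
open Literature.MathematicalPhysics.QuantumFieldTheory.Balaban1983to89.TreeLengthTorus (TPt torusTreeLen torusTreeLen_nonneg)
open Literature.MathematicalPhysics.QuantumFieldTheory.Balaban1983to89.B12TreeDecay (K₀ kappa₀ K₀_pos)
open Literature.MathematicalPhysics.QuantumFieldTheory.Balaban1983to89.B12Decay510 (delta1)
open Literature.MathematicalPhysics.QuantumFieldTheory.Balaban1983to89.B12Decay510Window (K₁)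
open Literature.MathematicalPhysics.QuantumFieldTheory.Balaban1983to89.B12Decay510Torus (distCT nearT)
open Literature.MathematicalPhysics.QuantumFieldTheory.Balaban1983to89.Node00
open Literature.MathematicalPhysics.QuantumFieldTheory.Balaban1983to89.Node00.Sect2 (domSys domCount CPair)
open Literature.MathematicalPhysics.QuantumFieldTheory.Balaban1983to89.Node00.W1
open Literature.MathematicalPhysics.QuantumFieldTheory.Balaban1983to89.Node00.LocalizedSum17 (localizedSum ReadingMaps)
open Literature.MathematicalPhysics.QuantumFieldTheory.Balaban1983to89.Node00.U3OfKernels (histPrefix histPrefix_apply)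
open Literature.MathematicalPhysics.QuantumFieldTheory.Balaban1983to89.Node00.U3KernelLetters (WindowedNE9)
open YMDAG.N22.WindowSoftTwoPoint (windowedNE9_localizedSum_of_softSum sum_moduli_histPrefix_eq_sum_range)
open YMDAG.N22.WindowedOfCouplingHolo (histPrefix_mem_box)

variable (F : T4Family) {𝔄 : Type*} [NormedRing 𝔄] [NormedAlgebra ℝ 𝔄] {V : Type*} [NormedAddCommGroup V] [NormedSpace ℝ V]
  {ι' : Type*} [Fintype ι'] {𝔸 : Type*} {M : ℕ}

open Classical in
/-- ★★★ **THE (β′) LETTER FROM OLDER ACTIVITY MARGINS + AN OUTPUT-LEVEL LAST-COUPLING LETTER.**  For node00-def-W1's term family `localizedSum F S emb` (W1-20), a window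
`W ⊆ Window γ`, cube side `M = L^{m′}`: IF at every tower `S K` and level `k` (i) printed (2.38) `Bound238 ((S K) k) (box γ k) (sp K k) A R` holds (node N10), (ii) the activities
carry coupling-holomorphy margin data in the OLDER coordinates `i < k` (radii `ϱt (k+1) i`, bound `A·e^{−R d_{k+1}(Z)}`; N10's T-row complexified where no cut-off is met), (iii)
the (2.13) terms carry the OUTPUT-level last-coupling Lipschitz letter `‖E^{(k+1)}(X;g;φ) − E^{(k+1)}(X;g|g_k:=t;φ)‖ ≤ Λ_E e^{−κd_{k+1}(X)}|g_k − t|` on `φ ∈ sp K k X` ([I]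
p. 263 at OUTPUT level; node N09's `EHoloAt` via part 1 §3), with Road 1's numerals once; IF per `(K, k, X)` the complexified probe reading `Φ K k X` on an open `U K k X ⊇ ball 0 r`
extends the reading of the exponential chart, maps `U K k X` into the space of every polymer inside `X` and makes every activity `z ↦ H(Z; histPrefix g k; Φ K k X z)`
holomorphic, and the complexifications' site weights carry the minimizer tails `w ≤ B₃e^{−δ₀ distCT(·, X)}` ([I] p. 282), `δ₀ > 0`, `2κ₀(64,8) ≤ κ ≤ r₁`: THEN W1-19b's binder
`WindowedNE9 F (localizedSum F S emb) ρ bV W δ₁ (C·Λ^D)` holds with `Λ^D n i = if i + 1 < n then c₀·4A∕ϱt n i else Λ_E`, `c₀ = 8·e·9·64·K₀(64,8)²`,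
`C = (16B₃²∕r²)e^{12Mδ₁}K₀(64,8)K₁(4,δ₀∕2)`, `δ₁ = ½min{δ₀, κ(4M)⁻¹}` — part 1 §4 composed with dag-n22-w2's `windowedNE9_localizedSum_of_softSum` BY NAME.  NO activity-level
slot in the last coupling appears among the hypotheses. [cite: Balaban1987RG1, §1 p.263, (1.7) p.261, (1.20)-(1.21) p.264 and (5.10) p.293; Balaban1988RG2Cluster, (2.3) p.12, (2.13) p.14, (2.38) p.20 and (2.39)-(2.41) p.21] -/
theorem windowedNE9_localizedSum_of_olderCoordHolo_lastLetter (m' : ℕ) (M : ℕ) [NeZero M] (hM : M = F.L ^ m')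
    (S : (K : ℕ) → ClusterTower (F.P K) 𝔸 M) (emb : ReadingMaps F 𝔄 𝔸) (ρ : V →L[ℝ] 𝔄) (bV : Module.Basis ι' ℝ V)
    {γ : ℝ} (W : Set (ℕ → ℝ)) (hWγ : W ⊆ Window γ)
    (sp : (K k : ℕ) → (domSys (F.P K) M (k + 1)).Dom → Set (CPair (F.P K) 𝔸))
    {A R r₁ κ δ₀ B₃ r ΛE : ℝ} (ϱt : ℕ → ℕ → ℝ) (hϱt : ∀ n i, 0 < ϱt n i)
    (hA : 0 < A) (hr₁ : 0 ≤ r₁) (hκ : κ ≤ r₁) (hκ₀ : kappa₀ (4 * 2 ^ 4) (2 * 4) ≤ κ / 2) (hrate : r₁ + 2 * (64 * Real.log 162) + 2 ≤ R)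
    (hsmall : 2 * A * Real.exp (5 * r₁ + 1) * K₀ 64 8 * 9 * 64 ≤ 1) (hδ₀ : 0 < δ₀) (hB₃ : 0 ≤ B₃) (hr : 0 < r) (hΛE : 0 ≤ ΛE)
    (h238 : ∀ K k, ((S K) k).Bound238 (box γ k) (sp K k) A R)
    (hO : ∀ (K k : ℕ), ∀ g ∈ box γ k, ∀ (Z : (domSys (F.P K) M (k + 1)).Dom), ∀ φ ∈ sp K k Z, ∀ i : Fin (k + 1), (i : ℕ) < k →
      ∃ (Hc : ℂ → ℂ) (O : Set ℂ), DifferentiableOn ℂ Hc O ∧ (∀ t ∈ Ioc (0 : ℝ) γ, closedBall (t : ℂ) (ϱt (k + 1) i) ⊆ O) ∧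
        (∀ z ∈ O, ‖Hc z‖ ≤ A * Real.exp (-(R * (domSys (F.P K) M (k + 1)).dj Z))) ∧
        (∀ t ∈ Ioc (0 : ℝ) γ, Hc t = ((S K) k).H (Function.update g i t) φ Z))
    (hlast : ∀ (K k : ℕ), ∀ g ∈ box γ k, ∀ t ∈ Ioc (0 : ℝ) γ, ∀ (X : (domSys (F.P K) M (k + 1)).Dom), ∀ φ ∈ sp K k X,
      ‖((S K) k).E g φ X - ((S K) k).E (Function.update g (Fin.last k) t) φ X‖ ≤ ΛE * Real.exp (-(κ * torusTreeLen X.1)) * |g (Fin.last k) - t|)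
    (Ec : ℕ → ℕ → Type*) [∀ K k, NormedAddCommGroup (Ec K k)] [∀ K k, NormedSpace ℂ (Ec K k)]
    (ι : (K k : ℕ) → (domSys (F.P K) M (k + 1)).Dom → ((Fin (F.P K).d → Site (F.P K) (k + 1) → V) →L[ℝ] Ec K k))
    (Φ : (K k : ℕ) → (domSys (F.P K) M (k + 1)).Dom → Ec K k → CPair (F.P K) 𝔸)
    (U : (K k : ℕ) → (domSys (F.P K) M (k + 1)).Dom → Set (Ec K k)) (hU : ∀ K k X, IsOpen (U K k X)) (hrU : ∀ K k X, ball (0 : Ec K k) r ⊆ U K k X)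
    (hHhol : ∀ g ∈ W, ∀ (K k : ℕ) (X Z : (domSys (F.P K) M (k + 1)).Dom), Z.1 ⊆ X.1 →
      DifferentiableOn ℂ (fun z => ((S K) k).H (histPrefix g k) (Φ K k X z) Z) (U K k X))
    (hΦemb : ∀ (K k : ℕ) (X : (domSys (F.P K) M (k + 1)).Dom) (B : Fin (F.P K).d → Site (F.P K) (k + 1) → V),
      Φ K k X (ι K k X B) = emb K k (fun l t => NormedSpace.exp (ρ (B l t))))
    (hΦsp : ∀ (K k : ℕ) (X : (domSys (F.P K) M (k + 1)).Dom), ∀ z ∈ U K k X, ∀ Z : (domSys (F.P K) M (k + 1)).Dom, Z.1 ⊆ X.1 → Φ K k X z ∈ sp K k Z)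
    (w : (K k : ℕ) → (domSys (F.P K) M (k + 1)).Dom → Site (F.P K) (k + 1) → ℝ) (hw₀ : ∀ K k X t, 0 ≤ w K k X t)
    (hw : ∀ (K k : ℕ) (X : (domSys (F.P K) M (k + 1)).Dom) (l : Fin (F.P K).d) (t : Site (F.P K) (k + 1)) (c : ι'),
      ‖ι K k X (Pi.single l (Pi.single t (bV c)))‖ ≤ w K k X t)
    (htail : ∀ (K k : ℕ) (X : (domSys (F.P K) M (k + 1)).Dom) (t : Site (F.P K) (k + 1)),
      let e : Site (F.P K) (k + 1) → TPt 4 (domCount (F.P K) M (k + 1) * M) := fun x i => (ZMod.cast (x i) : ZMod (domCount (F.P K) M (k + 1) * M))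
      w K k X t ≤ B₃ * Real.exp (-δ₀ * distCT (domCount (F.P K) M (k + 1)) M (e t) (nearT (M := M) (e t) X))) :
    WindowedNE9 F (localizedSum F S emb) ρ bV W (delta1 δ₀ κ ((M : ℝ) * 4))
      (fun n i => 16 * B₃ ^ 2 / r ^ 2 * Real.exp (delta1 δ₀ κ ((M : ℝ) * 4) * ((M : ℝ) * 4) * 3) * K₀ (4 * 2 ^ 4) (2 * 4) * K₁ 4 (δ₀ / 2) *
        (if i + 1 < n then 8 * (Real.exp 1 * 9 * 64 * K₀ 64 8 ^ 2) * (4 * A / ϱt n i) else ΛE)) := by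
  have hK : 0 < K₀ 64 8 := K₀_pos 64 8
  have hΛD : ∀ n i : ℕ, (0 : ℝ) ≤ (if i + 1 < n then 8 * (Real.exp 1 * 9 * 64 * K₀ 64 8 ^ 2) * (4 * A / ϱt n i) else ΛE) := by
    intro n i
    split_ifs
    · have := hϱt n i
      have := hA.le
      positivity
    · exact hΛE
  have hCE : (0 : ℝ) ≤ 16 * B₃ ^ 2 / r ^ 2 := by positivity
  refine windowedNE9_localizedSum_of_softSum F m' M hM S emb ρ bV W
    (fun n i => if i + 1 < n then 8 * (Real.exp 1 * 9 * 64 * K₀ 64 8 ^ 2) * (4 * A / ϱt n i) else ΛE) hΛD hCE hδ₀ hκ₀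
    (fun g g' k μ ν z K X => 16 * (Real.exp (-(κ * torusTreeLen X.1)) *
        ∑ i : Fin (k + 1), (if (i : ℕ) + 1 < k + 1 then 8 * (Real.exp 1 * 9 * 64 * K₀ 64 8 ^ 2) * (4 * A / ϱt (k + 1) i) else ΛE) *
          |histPrefix g k i - histPrefix g' k i|) / r ^ 2 *
        (w K k X (siteOfInt F K (k + 1) z) * w K k X (siteOfInt F K (k + 1) 0)))
    (fun g hg g' hg' k μ ν z K => ?_) (fun g hg g' hg' k μ ν z K X => ?_)
  · exact abs_polWindow_localizedSum_sub_le_soft_of_dichotomy F S emb ρ bV k K (sp K k) (fun i : Fin (k + 1) => ϱt (k + 1) i)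
      (fun i : Fin (k + 1) => if (i : ℕ) + 1 < k + 1 then 8 * (Real.exp 1 * 9 * 64 * K₀ 64 8 ^ 2) * (4 * A / ϱt (k + 1) i) else ΛE)
      hA hr₁ hκ hrate hsmall (fun i => hϱt _ _)
      (fun i hi => by simp only [if_pos (show (i : ℕ) + 1 < k + 1 by omega), le_refl])
      (by simp only [Fin.val_last, lt_self_iff_false, if_false, le_refl])
      (h238 K k) (hO K k) (hlast K k) (histPrefix_mem_box (hWγ hg) k) (histPrefix_mem_box (hWγ hg') k)
      (ι K k) (Φ K k) (U K k) (hU K k) hr (hrU K k) (hHhol g hg K k) (hHhol g' hg' K k) (hΦemb K k) (hΦsp K k) (w K k) (hw₀ K k) (hw K k) μ ν z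
  · exact dichotomySummand_le_softMajorant (Finset.sum_nonneg fun i _ => mul_nonneg (hΛD _ _) (abs_nonneg _))
      (sum_moduli_histPrefix_eq_sum_range
        (fun n i => if i + 1 < n then 8 * (Real.exp 1 * 9 * 64 * K₀ 64 8 ^ 2) * (4 * A / ϱt n i) else ΛE) g g' k)
      hr hB₃ (hw₀ K k X _) (Real.exp_nonneg _) (htail K k X _) (htail K k X _)

open Classical in
/-- ★★★ **THE (β′) LETTER FROM OLDER ACTIVITY MARGINS + NODE N09's OUTPUT-LEVEL LAST-COUPLING DATUM.**  As `windowedNE9_localizedSum_of_olderCoordHolo_lastLetter` with the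
letter DISCHARGED (part 1 §3 `lastLetter_of_lastOutputHolo`) from an `EHoloAt`-shape datum per `(K, k)`: for every box prefix `g`, `X ∈ 𝐃_{k+1}` and `φ ∈ sp K k X` a holomorphic
extension of `t ↦ E^{(k+1)}(X; g|g_k := t; φ)` to a set containing the closed `r_E`-discs about `]0, γ]`, bounded by `B·e^{−κ_E d_{k+1}(X)}`, `κ ≤ κ_E` ([I] p. 263
«(or analytic)» + (1.18) on the margin); last letter `Λ_E = 4B∕r_E`. [cite: Balaban1987RG1, §1 p.263 (clause before (1.18)), (1.7) p.261, (1.20)-(1.21) p.264 and (5.10) p.293; Balaban1988RG2Cluster, (2.3) p.12, (2.13) p.14, (2.38) p.20 and (2.39)-(2.41) p.21] -/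
theorem windowedNE9_localizedSum_of_olderCoordHolo_lastOutputHolo (m' : ℕ) (M : ℕ) [NeZero M] (hM : M = F.L ^ m')
    (S : (K : ℕ) → ClusterTower (F.P K) 𝔸 M) (emb : ReadingMaps F 𝔄 𝔸) (ρ : V →L[ℝ] 𝔄) (bV : Module.Basis ι' ℝ V)
    {γ : ℝ} (W : Set (ℕ → ℝ)) (hWγ : W ⊆ Window γ)
    (sp : (K k : ℕ) → (domSys (F.P K) M (k + 1)).Dom → Set (CPair (F.P K) 𝔸))
    {A R r₁ κ κE δ₀ B₃ r B rE : ℝ} (ϱt : ℕ → ℕ → ℝ) (hϱt : ∀ n i, 0 < ϱt n i)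
    (hA : 0 < A) (hr₁ : 0 ≤ r₁) (hκ : κ ≤ r₁) (hκ₀ : kappa₀ (4 * 2 ^ 4) (2 * 4) ≤ κ / 2) (hrate : r₁ + 2 * (64 * Real.log 162) + 2 ≤ R)
    (hsmall : 2 * A * Real.exp (5 * r₁ + 1) * K₀ 64 8 * 9 * 64 ≤ 1) (hδ₀ : 0 < δ₀) (hB₃ : 0 ≤ B₃) (hr : 0 < r)
    (hB : 0 ≤ B) (hrE : 0 < rE) (hκE : κ ≤ κE)
    (h238 : ∀ K k, ((S K) k).Bound238 (box γ k) (sp K k) A R)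
    (hO : ∀ (K k : ℕ), ∀ g ∈ box γ k, ∀ (Z : (domSys (F.P K) M (k + 1)).Dom), ∀ φ ∈ sp K k Z, ∀ i : Fin (k + 1), (i : ℕ) < k →
      ∃ (Hc : ℂ → ℂ) (O : Set ℂ), DifferentiableOn ℂ Hc O ∧ (∀ t ∈ Ioc (0 : ℝ) γ, closedBall (t : ℂ) (ϱt (k + 1) i) ⊆ O) ∧
        (∀ z ∈ O, ‖Hc z‖ ≤ A * Real.exp (-(R * (domSys (F.P K) M (k + 1)).dj Z))) ∧
        (∀ t ∈ Ioc (0 : ℝ) γ, Hc t = ((S K) k).H (Function.update g i t) φ Z))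
    (hL : ∀ (K k : ℕ), ∀ g ∈ box γ k, ∀ (X : (domSys (F.P K) M (k + 1)).Dom), ∀ φ ∈ sp K k X,
      ∃ (Ec : ℂ → ℂ) (O : Set ℂ), DifferentiableOn ℂ Ec O ∧ (∀ t ∈ Ioc (0 : ℝ) γ, closedBall (t : ℂ) rE ⊆ O) ∧
        (∀ z ∈ O, ‖Ec z‖ ≤ B * Real.exp (-(κE * torusTreeLen X.1))) ∧
        (∀ t ∈ Ioc (0 : ℝ) γ, Ec t = ((S K) k).E (Function.update g (Fin.last k) t) φ X))
    (Ec : ℕ → ℕ → Type*) [∀ K k, NormedAddCommGroup (Ec K k)] [∀ K k, NormedSpace ℂ (Ec K k)]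
    (ι : (K k : ℕ) → (domSys (F.P K) M (k + 1)).Dom → ((Fin (F.P K).d → Site (F.P K) (k + 1) → V) →L[ℝ] Ec K k))
    (Φ : (K k : ℕ) → (domSys (F.P K) M (k + 1)).Dom → Ec K k → CPair (F.P K) 𝔸)
    (U : (K k : ℕ) → (domSys (F.P K) M (k + 1)).Dom → Set (Ec K k)) (hU : ∀ K k X, IsOpen (U K k X)) (hrU : ∀ K k X, ball (0 : Ec K k) r ⊆ U K k X)
    (hHhol : ∀ g ∈ W, ∀ (K k : ℕ) (X Z : (domSys (F.P K) M (k + 1)).Dom), Z.1 ⊆ X.1 →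
      DifferentiableOn ℂ (fun z => ((S K) k).H (histPrefix g k) (Φ K k X z) Z) (U K k X))
    (hΦemb : ∀ (K k : ℕ) (X : (domSys (F.P K) M (k + 1)).Dom) (B : Fin (F.P K).d → Site (F.P K) (k + 1) → V),
      Φ K k X (ι K k X B) = emb K k (fun l t => NormedSpace.exp (ρ (B l t))))
    (hΦsp : ∀ (K k : ℕ) (X : (domSys (F.P K) M (k + 1)).Dom), ∀ z ∈ U K k X, ∀ Z : (domSys (F.P K) M (k + 1)).Dom, Z.1 ⊆ X.1 → Φ K k X z ∈ sp K k Z)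
    (w : (K k : ℕ) → (domSys (F.P K) M (k + 1)).Dom → Site (F.P K) (k + 1) → ℝ) (hw₀ : ∀ K k X t, 0 ≤ w K k X t)
    (hw : ∀ (K k : ℕ) (X : (domSys (F.P K) M (k + 1)).Dom) (l : Fin (F.P K).d) (t : Site (F.P K) (k + 1)) (c : ι'),
      ‖ι K k X (Pi.single l (Pi.single t (bV c)))‖ ≤ w K k X t)
    (htail : ∀ (K k : ℕ) (X : (domSys (F.P K) M (k + 1)).Dom) (t : Site (F.P K) (k + 1)),
      let e : Site (F.P K) (k + 1) → TPt 4 (domCount (F.P K) M (k + 1) * M) := fun x i => (ZMod.cast (x i) : ZMod (domCount (F.P K) M (k + 1) * M))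
      w K k X t ≤ B₃ * Real.exp (-δ₀ * distCT (domCount (F.P K) M (k + 1)) M (e t) (nearT (M := M) (e t) X))) :
    WindowedNE9 F (localizedSum F S emb) ρ bV W (delta1 δ₀ κ ((M : ℝ) * 4))
      (fun n i => 16 * B₃ ^ 2 / r ^ 2 * Real.exp (delta1 δ₀ κ ((M : ℝ) * 4) * ((M : ℝ) * 4) * 3) * K₀ (4 * 2 ^ 4) (2 * 4) * K₁ 4 (δ₀ / 2) *
        (if i + 1 < n then 8 * (Real.exp 1 * 9 * 64 * K₀ 64 8 ^ 2) * (4 * A / ϱt n i) else 4 * B / rE)) :=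
  windowedNE9_localizedSum_of_olderCoordHolo_lastLetter F m' M hM S emb ρ bV W hWγ sp ϱt hϱt hA hr₁ hκ hκ₀ hrate hsmall hδ₀ hB₃ hr
    (by positivity) h238 hO (fun K k => lastLetter_of_lastOutputHolo F K ((S K) k) (sp K k) hB hrE hκE (hL K k))
    Ec ι Φ U hU hrU hHhol hΦemb hΦsp w hw₀ hw htail

open Classical in
/-- ★ **THE (β′) LETTER, VERTEX EDITION AT OUTPUT LEVEL** — print's dilation shape where print puts the last coupling's regularity: as
`windowedNE9_localizedSum_of_olderCoordHolo_lastLetter` with the letter DISCHARGED (part 1 §3 `lastLetter_of_lastOutputHoloRel`) from the RELATIVE-disc datum per `(K, k)`: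
a holomorphic extension of `t ↦ E^{(k+1)}(X; g|g_k := t; φ)` on a set containing the discs `D̄(s, c·s)`, `s ∈ ]0, γ]`, bounded there by `B′·s·e^{−κ_E d_{k+1}(X)}`
(vanishing linearly at the vertex; the cell's reading (L5)∕[H-dil], NOT a printed estimate); last letter `Λ_E = 8B′∕min(c,1)`.
[cite: Balaban1987RG1, §1 p.263 (clause before (1.18)), (1.20)-(1.21) p.264 and (5.10) p.293; Balaban1988RG2Cluster, (2.3) p.12, (2.13) p.14, (2.38) p.20 and (2.39)-(2.41) p.21] -/
theorem windowedNE9_localizedSum_of_olderCoordHolo_lastOutputHoloRel (m' : ℕ) (M : ℕ) [NeZero M] (hM : M = F.L ^ m')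
    (S : (K : ℕ) → ClusterTower (F.P K) 𝔸 M) (emb : ReadingMaps F 𝔄 𝔸) (ρ : V →L[ℝ] 𝔄) (bV : Module.Basis ι' ℝ V)
    {γ : ℝ} (W : Set (ℕ → ℝ)) (hWγ : W ⊆ Window γ)
    (sp : (K k : ℕ) → (domSys (F.P K) M (k + 1)).Dom → Set (CPair (F.P K) 𝔸))
    {A R r₁ κ κE δ₀ B₃ r B' c : ℝ} (ϱt : ℕ → ℕ → ℝ) (hϱt : ∀ n i, 0 < ϱt n i)
    (hA : 0 < A) (hr₁ : 0 ≤ r₁) (hκ : κ ≤ r₁) (hκ₀ : kappa₀ (4 * 2 ^ 4) (2 * 4) ≤ κ / 2) (hrate : r₁ + 2 * (64 * Real.log 162) + 2 ≤ R)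
    (hsmall : 2 * A * Real.exp (5 * r₁ + 1) * K₀ 64 8 * 9 * 64 ≤ 1) (hδ₀ : 0 < δ₀) (hB₃ : 0 ≤ B₃) (hr : 0 < r)
    (hB' : 0 ≤ B') (hc : 0 < c) (hκE : κ ≤ κE)
    (h238 : ∀ K k, ((S K) k).Bound238 (box γ k) (sp K k) A R)
    (hO : ∀ (K k : ℕ), ∀ g ∈ box γ k, ∀ (Z : (domSys (F.P K) M (k + 1)).Dom), ∀ φ ∈ sp K k Z, ∀ i : Fin (k + 1), (i : ℕ) < k →
      ∃ (Hc : ℂ → ℂ) (O : Set ℂ), DifferentiableOn ℂ Hc O ∧ (∀ t ∈ Ioc (0 : ℝ) γ, closedBall (t : ℂ) (ϱt (k + 1) i) ⊆ O) ∧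
        (∀ z ∈ O, ‖Hc z‖ ≤ A * Real.exp (-(R * (domSys (F.P K) M (k + 1)).dj Z))) ∧
        (∀ t ∈ Ioc (0 : ℝ) γ, Hc t = ((S K) k).H (Function.update g i t) φ Z))
    (hL : ∀ (K k : ℕ), ∀ g ∈ box γ k, ∀ (X : (domSys (F.P K) M (k + 1)).Dom), ∀ φ ∈ sp K k X,
      ∃ (Ec : ℂ → ℂ) (O : Set ℂ), DifferentiableOn ℂ Ec O ∧ (∀ s ∈ Ioc (0 : ℝ) γ, closedBall (s : ℂ) (c * s) ⊆ O) ∧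
        (∀ s ∈ Ioc (0 : ℝ) γ, ∀ z ∈ closedBall (s : ℂ) (c * s), ‖Ec z‖ ≤ B' * s * Real.exp (-(κE * torusTreeLen X.1))) ∧
        (∀ s ∈ Ioc (0 : ℝ) γ, Ec s = ((S K) k).E (Function.update g (Fin.last k) s) φ X))
    (Ec : ℕ → ℕ → Type*) [∀ K k, NormedAddCommGroup (Ec K k)] [∀ K k, NormedSpace ℂ (Ec K k)]
    (ι : (K k : ℕ) → (domSys (F.P K) M (k + 1)).Dom → ((Fin (F.P K).d → Site (F.P K) (k + 1) → V) →L[ℝ] Ec K k))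
    (Φ : (K k : ℕ) → (domSys (F.P K) M (k + 1)).Dom → Ec K k → CPair (F.P K) 𝔸)
    (U : (K k : ℕ) → (domSys (F.P K) M (k + 1)).Dom → Set (Ec K k)) (hU : ∀ K k X, IsOpen (U K k X)) (hrU : ∀ K k X, ball (0 : Ec K k) r ⊆ U K k X)
    (hHhol : ∀ g ∈ W, ∀ (K k : ℕ) (X Z : (domSys (F.P K) M (k + 1)).Dom), Z.1 ⊆ X.1 →
      DifferentiableOn ℂ (fun z => ((S K) k).H (histPrefix g k) (Φ K k X z) Z) (U K k X))
    (hΦemb : ∀ (K k : ℕ) (X : (domSys (F.P K) M (k + 1)).Dom) (B : Fin (F.P K).d → Site (F.P K) (k + 1) → V),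
      Φ K k X (ι K k X B) = emb K k (fun l t => NormedSpace.exp (ρ (B l t))))
    (hΦsp : ∀ (K k : ℕ) (X : (domSys (F.P K) M (k + 1)).Dom), ∀ z ∈ U K k X, ∀ Z : (domSys (F.P K) M (k + 1)).Dom, Z.1 ⊆ X.1 → Φ K k X z ∈ sp K k Z)
    (w : (K k : ℕ) → (domSys (F.P K) M (k + 1)).Dom → Site (F.P K) (k + 1) → ℝ) (hw₀ : ∀ K k X t, 0 ≤ w K k X t)
    (hw : ∀ (K k : ℕ) (X : (domSys (F.P K) M (k + 1)).Dom) (l : Fin (F.P K).d) (t : Site (F.P K) (k + 1)) (c : ι'),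
      ‖ι K k X (Pi.single l (Pi.single t (bV c)))‖ ≤ w K k X t)
    (htail : ∀ (K k : ℕ) (X : (domSys (F.P K) M (k + 1)).Dom) (t : Site (F.P K) (k + 1)),
      let e : Site (F.P K) (k + 1) → TPt 4 (domCount (F.P K) M (k + 1) * M) := fun x i => (ZMod.cast (x i) : ZMod (domCount (F.P K) M (k + 1) * M))
      w K k X t ≤ B₃ * Real.exp (-δ₀ * distCT (domCount (F.P K) M (k + 1)) M (e t) (nearT (M := M) (e t) X))) :
    WindowedNE9 F (localizedSum F S emb) ρ bV W (delta1 δ₀ κ ((M : ℝ) * 4))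
      (fun n i => 16 * B₃ ^ 2 / r ^ 2 * Real.exp (delta1 δ₀ κ ((M : ℝ) * 4) * ((M : ℝ) * 4) * 3) * K₀ (4 * 2 ^ 4) (2 * 4) * K₁ 4 (δ₀ / 2) *
        (if i + 1 < n then 8 * (Real.exp 1 * 9 * 64 * K₀ 64 8 ^ 2) * (4 * A / ϱt n i) else 8 * B' / min c 1)) := by
  have hmin : 0 < min c 1 := lt_min hc one_pos
  exact windowedNE9_localizedSum_of_olderCoordHolo_lastLetter F m' M hM S emb ρ bV W hWγ sp ϱt hϱt hA hr₁ hκ hκ₀ hrate hsmall hδ₀ hB₃ hr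
    (by positivity) h238 hO (fun K k => lastLetter_of_lastOutputHoloRel F K ((S K) k) (sp K k) hB' hc hκE (hL K k))
    Ec ι Φ U hU hrU hHhol hΦemb hΦsp w hw₀ hw htail

end YMDAG.N22.Dichotomy

end
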